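import Mathlib.NumberTheory.LSeries.RiemannZeta
import Mathlib.MeasureTheory.Integral.IntervalIntegral.Basic
import Mathlib.Analysis.SpecialFunctions.Trigonometric.Arctan
import Mathlib.Topology.Order.Basic
import Literature.NumberTheory.LFunctions.RiemannXi
import Literature.NumberTheory.LFunctions.DeBruijnNewman
import HarnessLib

/-!
# The integral of Riemann's `ξ`-function (Lagarias–Montague 2011) — definition and named facts

Literature/NumberTheory/LFunctions. Lagarias–Montague, *The integral of the Riemann ξ-function*,
Comment. Math. Univ. St. Pauli 60 (2011) 143–169 (arXiv:1106.4348), study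
`ξ^{(-1)}(s) := ∫_{1/2}^{s} ξ(w) dw` (their eq. (1.2)) and `Ξ_λ^{(-1)}(z) := ∫_0^z Ξ_λ(w) dw`,
`Ξ_0 = Ξ`, with `Ξ_0^{(-1)}(z) = −i ξ^{(-1)}(½ + iz)` (Lemma 3.2 (3)).

This file vendors, as NAMED FACTS (nothing is asserted; users take `(h : <Fact>)`):

* `xiIntegral` — the segment primitive `ξ^{(-1)}(s) = (∫₀¹ ξ(½ + u(s − ½)) du)·(s − ½)` (REAL definition; it is
  literally the expression inlined by the statements of route `Summit.RiemannHypothesis.RiemannHypothesis.Theses.NodalHairpin`,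
  so `xiIntegral s` unfolds to them by `rfl`).
* `xiIntegralLimit` — the constant `A₀ := π Φ(0) ≈ 2.80668` of [LM, Thm. 2.1 (1)], written through the tree's
  Rodgers–Tao-normalised kernel `deBruijnPhi` (`Φ_Titchmarsh(u) = 2 Φ_RT(u/2)`, so `A₀ = 2π · deBruijnPhi 0`;
  LM, proof of Lemma 3.1: `Φ(0) = Σ (4π²n⁴ − 6πn²) e^{−πn²} ≈ 0.89339`).
* `lagariasMontagueF` — the comparison function `F(σ,t)` of [LM, eq. (3.3)].
* `LagariasMontague2011_thm_2_1_i` — `lim_{t→±∞} ξ^{(-1)}(½ + it) = ± i A₀` [LM, Thm. 2.1 (1) with λ = 0, eq. (2.6)].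
* `LagariasMontague2011_thm_2_1_i_rate` — `Ξ_0^{(-1)}(t) = A₀ + O(t^{-2/3})` for `t ≥ 3` [LM, eq. (2.3)].
* `LagariasMontague2011_thm_2_1_ii` — for `λ = 0 ≤ 0`, `t = 0` is the only real zero of `Ξ_0^{(-1)}`, i.e. `s = ½` is the only
  zero of `ξ^{(-1)}` on the critical line [LM, Thm. 2.1 (2)].
* `Wintner1947_xiIntegral_im_pos` — Wintner 1947: `Ξ_0^{(-1)}(t) > 0` for `t > 0` [LM §2.1, §4, reporting Wintner, Math. Notae 7].
* `LagariasMontague2011_lem_3_3_i` — `|ξ(s)| ≤ C₁ e^{−π|t|/4} (|t|+1)^{5/2}` on `½ ≤ Re s ≤ 2` [LM, Lemma 3.3 (1)].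
* `LagariasMontague2011_lem_3_3_ii` — two-sided Stirling-size estimate `|ξ(σ+it)| = F(σ,t)(1 + O(1/|σ+it| + 2^{-σ}))`
  for `σ ≥ 2` [LM, Lemma 3.3 (2)].
* `LagariasMontague2011_sec5_horizontal` — `|ξ^{(-1)}(σ+it) − ξ^{(-1)}(½+it)| ≤ C₄ e^{−π|t|/4}(|t|+1)^{5/2}`, `½ ≤ σ ≤ 2` [LM, §5].
* `LagariasMontague2011_sec5_uniform` — `ξ^{(-1)}(σ+it) → ± iA₀` as `t → ±∞`, uniformly on every vertical strip
  `σ₁ ≤ σ ≤ σ₂` [LM, §5, facts (1)–(2) at the start of the proof of Thm. 2.2].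

Grounds (route NodalHairpin): `NodalDecay` (= `LagariasMontague2011_sec5_uniform` ∘ taking real parts),
inputs of `NodalLadderFar` / `NodalLadderEuler` / `NodalProper` (size of `ξ` on horizontal lines, Lemma 3.3), and the
structure of `F = ξ^{(-1)}` on the critical line (`Re F = 0`, `Im F(½+it) > 0` for `t > 0`, limits `± A₀`).

Deliberately NOT here: LM Thm. 2.2 (value distribution `|σ| = (π/2)|t|/log|t| + O(|t|/log²|t|)` of the solutions of
`ξ^{(-1)}(s) = c`), the family `Ξ_λ^{(-1)}` for `λ ≠ 0`, and `Λ^{(-1)} = +∞`.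

## References
* J. C. Lagarias, D. Montague, *The integral of the Riemann ξ-function*, Comment. Math. Univ. St. Pauli 60 (2011),
  143–169; arXiv:1106.4348. (key `LagariasMontague2011`)
* A. Wintner, *On an oscillatory property of the Riemann Ξ-function*, Math. Notae 7 (1947), 177–178. (key `Wintner1947`)
* E. C. Titchmarsh, *The Theory of the Riemann Zeta-Function*, 2nd ed., Oxford 1986, §10.1.
-/

noncomputable section

open Complex MeasureTheory Real
open _root_.Filter
open scoped _root_.Topology

namespace Literature.NumberTheory.LFunctions

/-! ## Definitions -/

/-- The integral of Riemann's `ξ`-function along the segment from `½` to `s`: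
`ξ^{(-1)}(s) := ∫_{1/2}^{s} ξ(w) dw = (∫₀¹ ξ(½ + u (s − ½)) du) · (s − ½)` (Lagarias–Montague 2011, eq. (1.2);
`ξ` is entire, so the segment integral is the path-independent primitive vanishing at `½`). This is verbatim the
expression inlined in the statements of route `Summit.RiemannHypothesis.RiemannHypothesis.Theses.NodalHairpin`.
[cite: LagariasMontague2011, eq. (1.2)] -/
def xiIntegral (s : ℂ) : ℂ :=
  (∫ u in (0:ℝ)..1, riemannXi (1 / 2 + (u : ℂ) * (s - 1 / 2))) * (s - 1 / 2)

/-- The Lagarias–Montague constant `A₀ := π Φ(0) ≈ 2.80668` (LM 2011, Thm. 2.1 (1), eq. (2.2)), where `Φ` is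
Titchmarsh's kernel (`Ξ(z) = 2∫₀^∞ Φ(u) cos zu du`, LM Lemma 3.1, `Φ(0) = Σ_{n≥1}(4π²n⁴ − 6πn²)e^{−πn²} ≈ 0.89339`).
In the tree's Rodgers–Tao normalisation `Literature.NumberTheory.LFunctions.deBruijnPhi` one has
`Φ_Titchmarsh(u) = 2 · deBruijnPhi (u/2)`, hence `A₀ = 2π · deBruijnPhi 0`. Equivalently `A₀ = ∫₀^∞ Ξ(t) dt`.
[cite: LagariasMontague2011, Thm. 2.1 eq. (2.2)] -/
def xiIntegralLimit : ℝ :=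
  2 * Real.pi * deBruijnPhi 0

/-- The comparison function of Lagarias–Montague 2011, eq. (3.3):
`F(σ, t) := √π (2πe)^{−σ/2} (σ² + t²)^{(σ+3)/4} exp(−(t/2) arctan(t/σ))` (printed for `σ ≥ 0`, `t > 0`; the
expression is even in `t`). [cite: LagariasMontague2011, eq. (3.3)] -/
def lagariasMontagueF (σ t : ℝ) : ℝ :=
  Real.sqrt Real.pi * (2 * Real.pi * Real.exp 1) ^ (-σ / 2) * (σ ^ 2 + t ^ 2) ^ ((σ + 3) / 4) *
    Real.exp (-(t / 2) * Real.arctan (t / σ))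

/-! ## Named facts -/

/-- NAMED FACT (**Lagarias–Montague 2011, Thm. 2.1 (1)** with `λ = 0`, and eq. (2.6)): `lim_{t→∞} Ξ₀^{(-1)}(t) = A₀`
with `A₀ = πΦ(0) ≠ 0`; since `Ξ₀^{(-1)}(z) = −i ξ^{(-1)}(½ + iz)` (Lemma 3.2 (3)) and `Ξ₀^{(-1)}` is odd, this reads
`lim_{t→±∞} ξ^{(-1)}(½ + it) = ± i A₀` (printed as eq. (2.6)). [cite: LagariasMontague2011, Thm. 2.1 (1)] -/
def LagariasMontague2011_thm_2_1_i : Prop :=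
  Tendsto (fun t : ℝ => xiIntegral (1 / 2 + t * I)) atTop (𝓝 ((xiIntegralLimit : ℂ) * I)) ∧
    Tendsto (fun t : ℝ => xiIntegral (1 / 2 + t * I)) atBot (𝓝 (-((xiIntegralLimit : ℂ) * I)))

/-- NAMED FACT (**Lagarias–Montague 2011, eq. (2.3)**, proof of Thm. 2.1): for `t ≥ 3`,
`Ξ₀^{(-1)}(t) = A₀ + O(t^{−2/3})`; with `ξ^{(-1)}(½+it) = iΞ₀^{(-1)}(t)`:
`‖ξ^{(-1)}(½ + it) − iA₀‖ ≤ C t^{−2/3}`. [cite: LagariasMontague2011, Thm. 2.1 eq. (2.3)] -/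
def LagariasMontague2011_thm_2_1_i_rate : Prop :=
  ∃ C : ℝ, ∀ t : ℝ, 3 ≤ t →
    ‖xiIntegral (1 / 2 + t * I) - (xiIntegralLimit : ℂ) * I‖ ≤ C * t ^ (-(2 : ℝ) / 3)

/-- NAMED FACT (**Lagarias–Montague 2011, Thm. 2.1 (2)**, case `λ = 0 ≤ 0`): "The zeros on the real axis always
include a zero at `t = 0`, and for `λ ≤ 0` this is the only real zero of `Ξ_λ^{(-1)}(t)`"; through
`ξ^{(-1)}(½+it) = iΞ₀^{(-1)}(t)`: `ξ^{(-1)}` vanishes on the critical line only at `s = ½` (LM §2.1: "`ξ^{(-1)}(s)` has no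
zeros on the critical line except for a zero at `s = ½`"). [cite: LagariasMontague2011, Thm. 2.1 (2)] -/
def LagariasMontague2011_thm_2_1_ii : Prop :=
  ∀ t : ℝ, xiIntegral (1 / 2 + t * I) = 0 ↔ t = 0

/-- NAMED FACT (**Wintner 1947**, as reported in Lagarias–Montague 2011, §2.1 and §4: "Wintner [Wi47] proved that
`Ξ₀^{(-1)}(t) > 0` when `t > 0`"), with `Ξ₀^{(-1)}(t) = ∫₀ᵗ Ξ(u) du = Im ξ^{(-1)}(½ + it)` (`ξ^{(-1)}(½+it) = iΞ₀^{(-1)}(t)`,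
`Ξ₀^{(-1)}` real on the real axis, LM Lemma 3.2 (2)–(3)). [cite: Wintner1947, Thm. (via LagariasMontague2011 §2.1)] -/
def Wintner1947_xiIntegral_im_pos : Prop :=
  ∀ t : ℝ, 0 < t → 0 < (xiIntegral (1 / 2 + t * I)).im

/-- NAMED FACT (**Lagarias–Montague 2011, Lemma 3.3 (1)**): there is `C₁ > 0` such that for `½ ≤ Re s ≤ 2`,
`|ξ(s)| ≤ C₁ e^{−π|t|/4} (|t| + 1)^{5/2}` (`t = Im s`). Printed proof: `|½s(s−1)| = O(|t|²)`, `|π^{−s/2}| = O(1)`,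
`|Γ(s/2)| = O(e^{−π|t|/4})`, convexity `|ζ(s)| ≤ C|t|^{1/2}` for `σ ≥ ½`, `|t| ≥ 2`.
[cite: LagariasMontague2011, Lemma 3.3 (1)] -/
def LagariasMontague2011_lem_3_3_i : Prop :=
  ∃ C₁ : ℝ, 0 < C₁ ∧ ∀ s : ℂ, 1 / 2 ≤ s.re → s.re ≤ 2 →
    ‖riemannXi s‖ ≤ C₁ * Real.exp (-(Real.pi / 4) * |s.im|) * (|s.im| + 1) ^ (5 / 2 : ℝ)

/-- NAMED FACT (**Lagarias–Montague 2011, Lemma 3.3 (2)**): there are `C₂, C₃ > 0` such that for `s = σ + it` with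
`σ ≥ 2` and all real `t`,
`F(σ,t)(1 − C₂(1/|σ+it| + 2^{−σ})) ≤ |ξ(s)| ≤ F(σ,t)(1 + C₃(1/|σ+it| + 2^{−σ}))`, `F` = `lagariasMontagueF`
(Stirling for `Γ(s/2)` on `Re s ≥ ½`, `|ζ(s)| = 1 + O(2^{−σ})`). [cite: LagariasMontague2011, Lemma 3.3 (2)] -/
def LagariasMontague2011_lem_3_3_ii : Prop :=
  ∃ C₂ C₃ : ℝ, 0 < C₂ ∧ 0 < C₃ ∧ ∀ σ t : ℝ, 2 ≤ σ →
    lagariasMontagueF σ t * (1 - C₂ * (1 / ‖(σ : ℂ) + t * I‖ + (2 : ℝ) ^ (-σ))) ≤ ‖riemannXi (σ + t * I)‖ ∧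
      ‖riemannXi (σ + t * I)‖ ≤ lagariasMontagueF σ t * (1 + C₃ * (1 / ‖(σ : ℂ) + t * I‖ + (2 : ℝ) ^ (-σ)))

/-- NAMED FACT (**Lagarias–Montague 2011, §5**, display in the first case of the proof of Thm. 2.2): for
`½ ≤ σ ≤ 2` and all real `t`, `|ξ^{(-1)}(σ + it) − ξ^{(-1)}(½ + it)| ≤ C₄ e^{−π|t|/4} (|t| + 1)^{5/2}`
("which follows from Lemma 3.3 (1) by integration on a horizontal line").
[cite: LagariasMontague2011, §5 (proof of Thm. 2.2, first case)] -/
def LagariasMontague2011_sec5_horizontal : Prop :=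
  ∃ C₄ : ℝ, 0 < C₄ ∧ ∀ σ t : ℝ, 1 / 2 ≤ σ → σ ≤ 2 →
    ‖xiIntegral (σ + t * I) - xiIntegral (1 / 2 + t * I)‖ ≤
      C₄ * Real.exp (-(Real.pi / 4) * |t|) * (|t| + 1) ^ (5 / 2 : ℝ)

/-- NAMED FACT (**Lagarias–Montague 2011, §5, facts (1)–(2)** opening the proof of Thm. 2.2): "As `t → ∞` the function
`ξ^{(-1)}(σ + it)` approaches `iA₀` uniformly on any vertical strip `σ₁ ≤ σ ≤ σ₂`", and "as `t → −∞` the function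
`ξ^{(-1)}(σ + it)` approaches `−iA₀` uniformly on any vertical strip" (from Thm. 2.1 and `|ξ(s)| → 0` uniformly on
vertical strips, via `ξ^{(-1)}(σ₀+it) = ξ^{(-1)}(½+it) + ∫_{1/2}^{σ₀} ξ(σ+it) dσ`). Grounds
`Summit.RiemannHypothesis.RiemannHypothesis.Theses.NodalHairpin.NodalDecay` (take real parts: `|Re ξ^{(-1)}| ≤ ‖ξ^{(-1)} ∓ iA₀‖`).
[cite: LagariasMontague2011, §5 (1)–(2)] -/
def LagariasMontague2011_sec5_uniform : Prop :=
  ∀ σ₁ σ₂ ε : ℝ, 0 < ε → ∃ T : ℝ, ∀ σ t : ℝ, σ₁ ≤ σ → σ ≤ σ₂ → T ≤ t →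
    ‖xiIntegral (σ + t * I) - (xiIntegralLimit : ℂ) * I‖ < ε ∧
      ‖xiIntegral (σ + -t * I) + (xiIntegralLimit : ℂ) * I‖ < ε

/-! ## Sanity lemmas (definitional) -/

/-- `xiIntegral` unfolds to the inlined segment integral of route NodalHairpin. [folklore] -/
theorem xiIntegral_def (s : ℂ) :
    xiIntegral s = (∫ u in (0:ℝ)..1, riemannXi (1 / 2 + (u : ℂ) * (s - 1 / 2))) * (s - 1 / 2) := rfl

/-- `ξ^{(-1)}(½) = 0`. [folklore] -/
theorem xiIntegral_one_half : xiIntegral (1 / 2) = 0 := by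
  simp [xiIntegral]

end Literature.NumberTheory.LFunctions
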